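import Literature.AnabelianGeometry.EtaleTheta.Discharge.Sec3Prop34CnstOfRlfRFinite
import Literature.AlgebraicGeometry.Frobenioids.PiMonoprimePerfFactorial
import Literature.AlgebraicGeometry.Frobenioids.FactorizationTransport
import Literature.AlgebraicGeometry.Frobenioids.PerfectionPrimes
import Literature.AlgebraicGeometry.Frobenioids.PerfectionDivisorial
import HarnessLib

/-!
# Prime coordinates of the full product `∏_ι ℚ_{≥0}` ([FrdI] Def. 2.4 (i)): they are the evaluations; integer
# divisors `ι → ℤ` inside `(∏_ι ℚ_{≥0})^gp` (toolkit for the [EtTh] §3 `Λ = ℝ` models with infinitely many primes)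

S. Mochizuki, *The geometry of Frobenioids I* [FrdI], §0 pp.10–12 (primes, `M_𝔭`, monoprime monoids), Def. 2.4 (i)
p.47 (perf-factorial monoids; the factorization homomorphism `M^pf → ∏_𝔮 M^rlf_𝔮`) [cite: MochizukiFrdI2008,
Def. 2.4(i) p.47]; used for S. Mochizuki, *The étale theta function …* [EtTh], Def. 3.3 (iii) p.73 / Def. 3.6 (i) p.76
(the data `Φ₀`, `B₀ → Φ₀^gp`, `B₀^ℝ := ℝ·Φ₀^birat`) [cite: MochizukiEtTh2009, Def 3.3 p.73].  Cell abc-iut, sub-DAG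
`plan/L2/SUBDAG-EtTh-Thm37.md`, GAP-LEDGER G-w5d130-1 (objects with infinitely many primes); generalises part 1 of
`Discharge/Sec3Prop34CnstOfRlfRSupportNegativeCone.lean` (index set `ℚ_{≥0}`) to an arbitrary index type `ι`.

For `M := ∏_{i ∈ ι} ℚ_{≥0}` (a full product of perfect `ℚ`-monoprime monoids — perf-factorial by
`PiMonoprime.isPerfFactorial`, abc-iut-w4-d084; every `M^pf_𝔮` is `ℚ`-monoprime, `isQMonoprime_pfAt`):
* `exists_coord_eq_mul_eval` — for every prime `𝔮'` of `M^pf` and every chart `f : M^rlf_𝔮' ≅ ℝ_{≥0}` there is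
  `κ > 0` with `coord_𝔮'(ι m) = κ · m(j(𝔮'))` (`PiMonoprime.fmap_apply` + `Factorization.fmap_congr` +
  `RealificationCoord.chart_Q`); `jdx_congr_primeOf` — the prime of the index `i` has `j = i`;
* rational coordinates `c_i : M^gp → ℚ` and their joint injectivity `eq_of_c_eq`;
* `toGp : (ι → ℤ) → M^gp`, the integer divisor `d ↦ [d⁺]/[d⁻]`, a homomorphism (`toGpHom`) with `c_i (toGp d) = d i`
  and real prime coordinate `κ · d(j(𝔮'))` (`X_toGp`);
* `PrimeCoord.eq_of_coordGp_eq` — an element of `(M^rlf)^gp` (any perf-factorial `M`) is determined by its prime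
  coordinates.
Definitions are plumbing over existing interfaces; no statement of print is strengthened; nothing here bears on
[IUTchIII] Cor. 3.12.
-/

noncomputable section

namespace Literature.AnabelianGeometry.EtaleTheta

open Literature.AlgebraicGeometry.Frobenioids NNReal

universe u

/-! ### An element of `(M^rlf)^gp` is determined by its prime coordinates -/

namespace PrimeCoord

/-- **Joint injectivity of the prime coordinates on `(M^rlf)^gp`** (`M^rlf ⊆ ∏_𝔮 M^rlf_𝔮`, [FrdI] Def. 2.4 (i)).
[cite: MochizukiFrdI2008, Def. 2.4(i) p.48] -/
theorem eq_of_coordGp_eq {M : Type u} [CommMonoid M] {h : IsPerfFactorial M}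
    (f : ∀ 𝔮 : Primes (Perfection M), RlfAt M 𝔮 ≃* Multiplicative ℝ≥0)
    {x y : Algebra.GrothendieckGroup h.Rlf} (hxy : ∀ 𝔮, coordGp h 𝔮 (f 𝔮) x = coordGp h 𝔮 (f 𝔮) y) : x = y := by
  obtain ⟨p, p', rfl⟩ := IsPerfFactorial.Rlf.gp_exists_eq_div h x
  obtain ⟨q, q', rfl⟩ := IsPerfFactorial.Rlf.gp_exists_eq_div h y
  rw [div_eq_div_iff_mul_eq_mul, ← map_mul, ← map_mul]
  congr 1
  apply Subtype.ext
  funext 𝔮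
  have h1 := congrArg Multiplicative.toAdd (hxy 𝔮)
  simp only [map_div, toAdd_div, toAdd_coordGp_of] at h1
  have h2 : ((Multiplicative.toAdd (coord h 𝔮 (f 𝔮) (p * q')) : ℝ≥0) : ℝ) =
      ((Multiplicative.toAdd (coord h 𝔮 (f 𝔮) (q * p')) : ℝ≥0) : ℝ) := by
    rw [(coord h 𝔮 (f 𝔮)).map_mul p q', (coord h 𝔮 (f 𝔮)).map_mul q p', toAdd_mul, toAdd_mul, NNReal.coe_add,
      NNReal.coe_add]
    linarith
  have h3 : coord h 𝔮 (f 𝔮) (p * q') = coord h 𝔮 (f 𝔮) (q * p') :=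
    Multiplicative.toAdd.injective (NNReal.coe_injective h2)
  rw [coord_apply, coord_apply] at h3
  exact (f 𝔮).injective h3

end PrimeCoord

namespace PiNNRat

variable {ι : Type u}

/-! ### `∏_ι ℚ_{≥0}`: factors, perfectness, sharpness -/

/-- Each factor `ℚ_{≥0}` is (`ℚ`-)monoprime. [cite: MochizukiFrdI2008, §0 p.10] -/
theorem hP : ∀ _ : ι, IsMonoprime (Multiplicative ℚ≥0) := fun _ => IsMonoprime.ofQ ⟨⟨MulEquiv.refl _⟩⟩

/-- Each factor `ℚ_{≥0}` is perfect. [cite: MochizukiFrdI2008, §0 p.11] -/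
theorem hperf : ∀ _ : ι, IsPerfect (Multiplicative ℚ≥0) := fun _ => isPerfect_multiplicative_nnrat

/-- `∏_ι ℚ_{≥0}` is perfect. [cite: MochizukiFrdI2008, §0 p.11] -/
theorem isPerfect : IsPerfect (ι → Multiplicative ℚ≥0) := PiMonoprime.isPerfect (hperf (ι := ι))

/-- `∏_ι ℚ_{≥0}` is sharp. [cite: MochizukiFrdI2008, §0 p.11] -/
theorem isSharp : IsSharp (ι → Multiplicative ℚ≥0) :=
  PiMonoprime.isSharp fun i => MonoprimeStructure.isSharp (hP (ι := ι) i)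

/-- `∏_ι ℚ_{≥0}` is divisorial (hence integral: `M → M^gp` injective). [cite: MochizukiFrdI2008, §0 p.11] -/
theorem isDivisorial : IsDivisorial (ι → Multiplicative ℚ≥0) := PiMonoprime.isDivisorial (hP (ι := ι))

/-! ### Rational coordinates on `M^gp` and their joint injectivity -/

/-- The `i`-th coordinate `M → (ℚ, +)` (written multiplicatively). [cite: MochizukiFrdI2008, Def. 2.4(i) p.47] -/
def evalQ (i : ι) : (ι → Multiplicative ℚ≥0) →* Multiplicative ℚ :=
  (AddMonoidHom.toMultiplicative NNRat.coeHom.toAddMonoidHom).comp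
    (Pi.evalMonoidHom (fun _ : ι => Multiplicative ℚ≥0) i)

/-- The `i`-th coordinate extended to `M^gp → ℚ`. [cite: MochizukiFrdI2008, Def. 2.4(i) p.47] -/
def cQ (i : ι) : Algebra.GrothendieckGroup (ι → Multiplicative ℚ≥0) →* Multiplicative ℚ :=
  Algebra.GrothendieckGroup.lift (evalQ i)

/-- The rational coordinate `c_i(g) := toAdd (cQ i g)`. [cite: MochizukiFrdI2008, Def. 2.4(i) p.47] -/
def c (i : ι) (g : Algebra.GrothendieckGroup (ι → Multiplicative ℚ≥0)) : ℚ := Multiplicative.toAdd (cQ i g)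

/-- `cQ i [m] = evalQ i m`. [cite: MochizukiFrdI2008, Def. 2.4(i) p.47] -/
theorem cQ_of (i : ι) (m : ι → Multiplicative ℚ≥0) : cQ i (Algebra.GrothendieckGroup.of m) = evalQ i m := by
  have h := Algebra.GrothendieckGroup.lift.symm_apply_apply (evalQ i)
  rw [Algebra.GrothendieckGroup.lift_symm_apply] at h
  exact DFunLike.congr_fun h m

/-- `c_i [m] = m_i`. [cite: MochizukiFrdI2008, Def. 2.4(i) p.47] -/
theorem c_of (i : ι) (m : ι → Multiplicative ℚ≥0) :
    c i (Algebra.GrothendieckGroup.of m) = ((Multiplicative.toAdd (m i) : ℚ≥0) : ℚ) := by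
  rw [c, cQ_of]; rfl

/-- `c_i [m] ≥ 0`. [cite: MochizukiFrdI2008, Def. 2.4(i) p.47] -/
theorem c_of_nonneg (i : ι) (m : ι → Multiplicative ℚ≥0) : 0 ≤ c i (Algebra.GrothendieckGroup.of m) := by
  rw [c_of]; exact NNRat.coe_nonneg _

/-- `c_i` is additive. [cite: MochizukiFrdI2008, Def. 2.4(i) p.47] -/
theorem c_mul (i : ι) (g g' : Algebra.GrothendieckGroup (ι → Multiplicative ℚ≥0)) :
    c i (g * g') = c i g + c i g' := by
  rw [c, map_mul, toAdd_mul, c, c]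

/-- `c_i` on quotients. [cite: MochizukiFrdI2008, Def. 2.4(i) p.47] -/
theorem c_div (i : ι) (g g' : Algebra.GrothendieckGroup (ι → Multiplicative ℚ≥0)) :
    c i (g / g') = c i g - c i g' := by
  rw [c, map_div, toAdd_div, c, c]

/-- `c_i` on integer powers. [cite: MochizukiFrdI2008, Def. 2.4(i) p.47] -/
theorem c_zpow (i : ι) (g : Algebra.GrothendieckGroup (ι → Multiplicative ℚ≥0)) (n : ℤ) :
    c i (g ^ n) = n * c i g := by
  rw [c, map_zpow, toAdd_zpow, c, zsmul_eq_mul]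

/-- **Joint injectivity of the rational coordinates on `M^gp`** (`M = ∏_ι ℚ_{≥0}` is cancellative).
[cite: MochizukiFrdI2008, Def. 2.4(i) p.47] -/
theorem eq_of_c_eq {x y : Algebra.GrothendieckGroup (ι → Multiplicative ℚ≥0)} (hxy : ∀ i, c i x = c i y) :
    x = y := by
  obtain ⟨⟨a, b⟩, hx⟩ := (Localization.monoidOf (⊤ : Submonoid (ι → Multiplicative ℚ≥0))).surj x
  obtain ⟨⟨a', b'⟩, hy⟩ := (Localization.monoidOf (⊤ : Submonoid (ι → Multiplicative ℚ≥0))).surj y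
  have hx' : x = Algebra.GrothendieckGroup.of a / Algebra.GrothendieckGroup.of b.1 := eq_div_iff_mul_eq'.mpr hx
  have hy' : y = Algebra.GrothendieckGroup.of a' / Algebra.GrothendieckGroup.of b'.1 := eq_div_iff_mul_eq'.mpr hy
  rw [hx', hy', div_eq_div_iff_mul_eq_mul, ← map_mul, ← map_mul]
  congr 1
  funext i
  have h1 := hxy i
  rw [hx', hy', c_div, c_div, c_of, c_of, c_of, c_of, sub_eq_sub_iff_add_eq_add, ← NNRat.coe_add, ← NNRat.coe_add,
    NNRat.coe_inj, ← toAdd_mul, ← toAdd_mul] at h1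
  have h2 := Multiplicative.toAdd.injective h1
  rw [Pi.mul_apply, Pi.mul_apply, h2.symm.trans (mul_comm _ _)]
  exact mul_comm _ _

/-! ### Integer divisors `ι → ℤ` inside `M^gp` -/

/-- The positive part of an integer vector, as an element of `M = ∏_ι ℚ_{≥0}`. [cite: MochizukiEtTh2009, Def 3.3 p.73] -/
def posPart (d : ι → ℤ) : ι → Multiplicative ℚ≥0 := fun i => Multiplicative.ofAdd ((d i).toNat : ℚ≥0)

/-- The negative part of an integer vector, as an element of `M`. [cite: MochizukiEtTh2009, Def 3.3 p.73] -/
def negPart (d : ι → ℤ) : ι → Multiplicative ℚ≥0 := fun i => Multiplicative.ofAdd ((-d i).toNat : ℚ≥0)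

/-- **The integer divisor `d ∈ ℤ^ι` as an element `[d⁺]/[d⁻]` of `M^gp`.** [cite: MochizukiEtTh2009, Def 3.3 p.73] -/
def toGp (d : ι → ℤ) : Algebra.GrothendieckGroup (ι → Multiplicative ℚ≥0) :=
  Algebra.GrothendieckGroup.of (posPart d) / Algebra.GrothendieckGroup.of (negPart d)

/-- `c_i (toGp d) = d_i`. [cite: MochizukiEtTh2009, Def 3.3 p.73] -/
theorem c_toGp (d : ι → ℤ) (i : ι) : c i (toGp d) = d i := by
  rw [toGp, c_div, c_of, c_of, posPart, negPart, toAdd_ofAdd, toAdd_ofAdd, NNRat.coe_natCast, NNRat.coe_natCast]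
  exact_mod_cast Int.toNat_sub_toNat_neg (d i)

/-- `toGp` is additive: `toGp (d + d') = toGp d · toGp d'`. [cite: MochizukiEtTh2009, Def 3.3 p.73] -/
theorem toGp_add (d d' : ι → ℤ) : toGp (d + d') = toGp d * toGp d' :=
  eq_of_c_eq fun i => by rw [c_mul, c_toGp, c_toGp, c_toGp, Pi.add_apply, Int.cast_add]

/-- `toGp 0 = 1`. [cite: MochizukiEtTh2009, Def 3.3 p.73] -/
theorem toGp_zero : toGp (0 : ι → ℤ) = 1 :=
  eq_of_c_eq fun i => by rw [c_toGp, Pi.zero_apply, Int.cast_zero, c, map_one, toAdd_one]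

/-- **`toGp` as a homomorphism `(ℤ^ι, +) → M^gp`.** [cite: MochizukiEtTh2009, Def 3.3 p.73] -/
def toGpHom : Multiplicative (ι → ℤ) →* Algebra.GrothendieckGroup (ι → Multiplicative ℚ≥0) where
  toFun d := toGp (Multiplicative.toAdd d)
  map_one' := toGp_zero
  map_mul' d d' := by rw [toAdd_mul, toGp_add]

/-- `toGpHom` unfolded. [cite: MochizukiEtTh2009, Def 3.3 p.73] -/
@[simp] theorem toGpHom_apply (d : Multiplicative (ι → ℤ)) : toGpHom d = toGp (Multiplicative.toAdd d) := rfl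

/-- `toGp d` is the class of an element of `M` iff `d ≥ 0`; here the direction used: effective ⇒ `d ≥ 0`.
[cite: MochizukiEtTh2009, Prop 3.4 (ii) p.74] -/
theorem nonneg_of_toGp_eq_of {d : ι → ℤ} {x : ι → Multiplicative ℚ≥0} (h : toGp d = Algebra.GrothendieckGroup.of x)
    (i : ι) : 0 ≤ d i := by
  have h1 := c_toGp d i
  rw [h] at h1
  have h2 := c_of_nonneg i x
  rw [h1] at h2
  exact_mod_cast h2

/-! ### `∏_ι ℚ_{≥0}` is perf-factorial with `ℚ`-primes; its prime coordinates are the evaluations -/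

section PerfFactorial

variable [DecidableEq ι]

/-- `∏_ι ℚ_{≥0}` is perf-factorial (a FULL product of perfect monoprime monoids, [FrdI] Def. 2.4 (i)).
[cite: MochizukiFrdI2008, Def. 2.4(i) p.47] -/
theorem isPerfFactorial : IsPerfFactorial (ι → Multiplicative ℚ≥0) :=
  PiMonoprime.isPerfFactorial (hP (ι := ι)) hperf

/-- The canonical `e : M ≅ M^pf` (`M` is perfect). [cite: MochizukiFrdI2008, §0 p.11] -/
abbrev eM : (ι → Multiplicative ℚ≥0) ≃* Perfection (ι → Multiplicative ℚ≥0) := (isPerfect (ι := ι)).equivPerfection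

/-- The index `j(𝔮') ∈ ι` of a prime `𝔮'` of `M^pf ≅ M = ∏_ι ℚ_{≥0}` (`Prime(∏_i P_i) ≅ ι`).
[cite: MochizukiFrdI2008, §0 p.12] -/
def jdx (𝔮' : Primes (Perfection (ι → Multiplicative ℚ≥0))) : ι := PiMonoprime.idx hP (Factorization.pre eM 𝔮')

/-- Every prime of `M` is `ℚ`-monoprime (`M_𝔭 ≅ ℚ_{≥0}`, the `idx 𝔭`-th factor). [cite: MochizukiFrdI2008, §0 p.12] -/
theorem hZQ (𝔭 : Primes (ι → Multiplicative ℚ≥0)) : IsZMonoprime ↥𝔭.submonoid ∨ IsQMonoprime ↥𝔭.submonoid :=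
  Or.inr ⟨⟨PiMonoprime.submonoidEquiv hP 𝔭 (PiMonoprime.idx hP 𝔭) (PiMonoprime.primeOf_idx hP 𝔭)⟩⟩

/-- **Every `M^pf_𝔮'` is `ℚ`-monoprime.** [cite: MochizukiFrdI2008, Def. 2.4(i) p.47] -/
theorem isQMonoprime_pfAt (𝔮' : Primes (Perfection (ι → Multiplicative ℚ≥0))) :
    IsQMonoprime (PfAt (ι → Multiplicative ℚ≥0) 𝔮') :=
  RealifiedDivisorMonoids.Prop34Cnst.isQMonoprime_pfAt_of_forall isSharp hZQ 𝔮'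

/-- The chart `M^pf_𝔮' ≅ M_𝔮 ≅ ℚ_{≥0}` (`𝔮 = e⁻¹ 𝔮'`, evaluation at `idx 𝔮`). [cite: MochizukiFrdI2008, §0 p.12] -/
def e0 (𝔮' : Primes (Perfection (ι → Multiplicative ℚ≥0))) :
    Factorization.PAt (Perfection (ι → Multiplicative ℚ≥0)) 𝔮' ≃* Multiplicative ℚ≥0 :=
  (Factorization.subEquiv eM (Factorization.pre eM 𝔮') 𝔮' (Factorization.congr_pre eM 𝔮')).symm.trans
    (PiMonoprime.submonoidEquiv hP (Factorization.pre eM 𝔮') (PiMonoprime.idx hP (Factorization.pre eM 𝔮'))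
      (PiMonoprime.primeOf_idx hP (Factorization.pre eM 𝔮')))

/-- `e0` on the transported restriction `e(m|_j)` is `m(j)`. [cite: MochizukiFrdI2008, §0 p.12] -/
theorem e0_subEquiv_res (𝔮' : Primes (Perfection (ι → Multiplicative ℚ≥0))) (m : ι → Multiplicative ℚ≥0) :
    e0 𝔮' (Factorization.subEquiv eM (Factorization.pre eM 𝔮') 𝔮' (Factorization.congr_pre eM 𝔮')
      (PiMonoprime.res hP (Factorization.pre eM 𝔮') m)) = m (jdx 𝔮') := by
  show PiMonoprime.submonoidEquiv hP _ _ (PiMonoprime.primeOf_idx hP (Factorization.pre eM 𝔮'))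
    ((Factorization.subEquiv eM (Factorization.pre eM 𝔮') 𝔮' (Factorization.congr_pre eM 𝔮')).symm
      (Factorization.subEquiv eM (Factorization.pre eM 𝔮') 𝔮' (Factorization.congr_pre eM 𝔮')
        (PiMonoprime.res hP (Factorization.pre eM 𝔮') m))) = _
  rw [MulEquiv.symm_apply_apply]
  show (PiMonoprime.res hP (Factorization.pre eM 𝔮') m : ι → Multiplicative ℚ≥0)
    (PiMonoprime.idx hP (Factorization.pre eM 𝔮')) = _
  rw [PiMonoprime.coe_res, Pi.mulSingle_eq_same]
  rfl

/-- The `𝔮'`-component of the factorization homomorphism at `ι(m)`: the transported restriction `e(m|_j) ⊗ 1`.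
[cite: MochizukiFrdI2008, Def. 2.4(i) p.47] -/
theorem coe_toRealification_apply (𝔮' : Primes (Perfection (ι → Multiplicative ℚ≥0)))
    (m : ι → Multiplicative ℚ≥0) :
    ((isPerfFactorial.toRealification (Perfection.of _ m) : (isPerfFactorial (ι := ι)).Rlf) :
        RlfFactor (ι → Multiplicative ℚ≥0)) 𝔮' =
      Realification.of _ (Factorization.subEquiv eM (Factorization.pre eM 𝔮') 𝔮' (Factorization.congr_pre eM 𝔮')
        (PiMonoprime.res hP (Factorization.pre eM 𝔮') m)) := by
  have hc := congrFun (Factorization.fmap_congr eM m) 𝔮'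
  exact hc.trans ((congrArg (Factorization.rlfEquiv eM (Factorization.pre eM 𝔮') 𝔮' (Factorization.congr_pre eM 𝔮'))
    (PiMonoprime.fmap_apply hP m _)).trans (Realification.congr_of _ _))

/-- **The prime coordinates of `∏_ι ℚ_{≥0}` are the evaluations**: for every prime `𝔮'` of `M^pf` and every chart
`f : M^rlf_𝔮' ≅ ℝ_{≥0}` there is `κ > 0` with `coord_𝔮'(ι m) = κ · m(j(𝔮'))` for all `m ∈ M`.
[cite: MochizukiFrdI2008, Def. 2.4(i) p.47] -/
theorem exists_coord_eq_mul_eval (𝔮' : Primes (Perfection (ι → Multiplicative ℚ≥0)))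
    (f : RlfAt (ι → Multiplicative ℚ≥0) 𝔮' ≃* Multiplicative ℝ≥0) :
    ∃ κ : ℝ≥0, κ ≠ 0 ∧ ∀ m : ι → Multiplicative ℚ≥0,
      Multiplicative.toAdd (PrimeCoord.coord isPerfFactorial 𝔮' f
        (isPerfFactorial.toRealification (Perfection.of _ m))) =
        κ * ((Multiplicative.toAdd (m (jdx 𝔮')) : ℚ≥0) : ℝ≥0) := by
  obtain ⟨κ, hκ, hchart⟩ := RealificationCoord.chart_Q f (e0 𝔮')
  refine ⟨κ, hκ, fun m => ?_⟩
  rw [PrimeCoord.coord_apply, coe_toRealification_apply, hchart, e0_subEquiv_res]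

/-- The index of the transported prime `e(𝔭_i)` is `i`. [cite: MochizukiFrdI2008, §0 p.12] -/
theorem jdx_congr_primeOf (i : ι) : jdx (Primes.congr eM (PiMonoprime.primeOf (hP (ι := ι)) i)) = i :=
  (congrArg (PiMonoprime.idx hP) (Factorization.pre_congr eM _)).trans (PiMonoprime.idx_primeOf hP i)

/-- A family of charts `M^rlf_𝔮' ≅ ℝ_{≥0}` (every `M^pf_𝔮'` is monoprime). [cite: MochizukiFrdI2008, §0 p.10] -/
def chart (𝔮' : Primes (Perfection (ι → Multiplicative ℚ≥0))) :
    RlfAt (ι → Multiplicative ℚ≥0) 𝔮' ≃* Multiplicative ℝ≥0 :=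
  (RealificationCoord.nonempty_coord (IsMonoprime.ofQ (isQMonoprime_pfAt 𝔮'))).some

/-! ### The real prime coordinate of an integer divisor -/

/-- The canonical map `M^gp → (M^rlf)^gp`, `[m] ↦ [ι m]`. [cite: MochizukiFrdI2008, Prop. 5.3 p.103] -/
abbrev ιg : Algebra.GrothendieckGroup (ι → Multiplicative ℚ≥0) →* Algebra.GrothendieckGroup (isPerfFactorial (ι := ι)).Rlf :=
  MonGp.map (isPerfFactorial.toRealification.comp (Perfection.of _))

/-- The real prime coordinate `X(w) := coord_𝔮'([ι w])` of `w ∈ M^gp`. [cite: MochizukiFrdI2008, Def. 2.4(i) p.48] -/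
def X (𝔮' : Primes (Perfection (ι → Multiplicative ℚ≥0))) (f : RlfAt (ι → Multiplicative ℚ≥0) 𝔮' ≃* Multiplicative ℝ≥0)
    (w : Algebra.GrothendieckGroup (ι → Multiplicative ℚ≥0)) : ℝ :=
  Multiplicative.toAdd (PrimeCoord.coordGp isPerfFactorial 𝔮' f (ιg w))

variable (𝔮' : Primes (Perfection (ι → Multiplicative ℚ≥0))) (f : RlfAt (ι → Multiplicative ℚ≥0) 𝔮' ≃* Multiplicative ℝ≥0)

/-- `X` on quotients. [cite: MochizukiFrdI2008, Def. 2.4(i) p.48] -/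
theorem X_div (w w' : Algebra.GrothendieckGroup (ι → Multiplicative ℚ≥0)) : X 𝔮' f (w / w') = X 𝔮' f w - X 𝔮' f w' := by
  rw [X, map_div, map_div, toAdd_div, X, X]

/-- `X` on products. [cite: MochizukiFrdI2008, Def. 2.4(i) p.48] -/
theorem X_mul (w w' : Algebra.GrothendieckGroup (ι → Multiplicative ℚ≥0)) : X 𝔮' f (w * w') = X 𝔮' f w + X 𝔮' f w' := by
  rw [X, map_mul, map_mul, toAdd_mul, X, X]

/-- `X[m] = κ · m(j(𝔮'))` given the coordinate formula. [cite: MochizukiFrdI2008, Def. 2.4(i) p.48] -/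
theorem X_of {κ : ℝ≥0}
    (hκ : ∀ m : ι → Multiplicative ℚ≥0, Multiplicative.toAdd (PrimeCoord.coord isPerfFactorial 𝔮' f
      (isPerfFactorial.toRealification (Perfection.of _ m))) = κ * ((Multiplicative.toAdd (m (jdx 𝔮')) : ℚ≥0) : ℝ≥0))
    (m : ι → Multiplicative ℚ≥0) :
    X 𝔮' f (Algebra.GrothendieckGroup.of m) = (κ : ℝ) * ((Multiplicative.toAdd (m (jdx 𝔮')) : ℚ≥0) : ℝ) := by
  rw [X, MonGp.map_of, PrimeCoord.toAdd_coordGp_of, MonoidHom.comp_apply, hκ m, NNReal.coe_mul]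
  rfl

/-- **The real prime coordinate of an integer divisor: `X(toGp d) = κ · d(j(𝔮'))`.**
[cite: MochizukiFrdI2008, Def. 2.4(i) p.48] -/
theorem X_toGp {κ : ℝ≥0}
    (hκ : ∀ m : ι → Multiplicative ℚ≥0, Multiplicative.toAdd (PrimeCoord.coord isPerfFactorial 𝔮' f
      (isPerfFactorial.toRealification (Perfection.of _ m))) = κ * ((Multiplicative.toAdd (m (jdx 𝔮')) : ℚ≥0) : ℝ≥0))
    (d : ι → ℤ) : X 𝔮' f (toGp d) = (κ : ℝ) * (d (jdx 𝔮') : ℝ) := by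
  rw [toGp, X_div, X_of 𝔮' f hκ, X_of 𝔮' f hκ, posPart, negPart, toAdd_ofAdd, toAdd_ofAdd, ← mul_sub]
  congr 1
  have h1 : ((d (jdx 𝔮')).toNat : ℝ) - ((-d (jdx 𝔮')).toNat : ℝ) = (d (jdx 𝔮') : ℝ) := by
    exact_mod_cast Int.toNat_sub_toNat_neg (d (jdx 𝔮'))
  rw [← h1]
  push_cast
  ring

/-- The coordinate of a real combination `∏_k r_k • ι(toGp d_k)` is `κ · Σ_k r_k · d_k(j(𝔮'))`.
[cite: MochizukiFrdI2008, Def. 2.4(i) p.48] -/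
theorem toAdd_coordGp_prod_realSMul_toGp {κ : ℝ≥0}
    (hκ : ∀ m : ι → Multiplicative ℚ≥0, Multiplicative.toAdd (PrimeCoord.coord isPerfFactorial 𝔮' f
      (isPerfFactorial.toRealification (Perfection.of _ m))) = κ * ((Multiplicative.toAdd (m (jdx 𝔮')) : ℚ≥0) : ℝ≥0))
    {n : ℕ} (r : Fin n → ℝ) (d : Fin n → ι → ℤ) :
    Multiplicative.toAdd (PrimeCoord.coordGp isPerfFactorial 𝔮' f
      (∏ k, IsPerfFactorial.Rlf.realSMul isPerfFactorial (r k) (ιg (toGp (d k))))) =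
      (κ : ℝ) * ∑ k, r k * (d k (jdx 𝔮') : ℝ) := by
  rw [map_prod, toAdd_prod, Finset.mul_sum]
  refine Finset.sum_congr rfl fun k _ => ?_
  rw [PrimeCoord.toAdd_coordGp_realSMul]
  change r k * X 𝔮' f (toGp (d k)) = _
  rw [X_toGp 𝔮' f hκ]
  ring

end PerfFactorial

end PiNNRat

end Literature.AnabelianGeometry.EtaleTheta

end
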